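/-
Copyright (c) 2026 the pub-hodgecm-mathlib formalisation cell (harness21).  Prover seat hodgecm-mathlib-F0P3b-p01 (g11), 2026-09-01.  Road «S3-tree» (census «S3» v3, architect
A-p16 (g29) A-61∕A-62), brick T3′ «depth-zero κ-transfer», organ O8a-1 of the holder's DESIGN v1 ∕ O8 sub-deal: THE SELF-DUAL CYCLIC `O[γ]`-LATTICES FORM A `C∕O[γ]^×`-TORSOR,
so their number is the relative index `[C : O[γ]^×]` (hypothesis-free tokens: `Algebra.adjoin O {γ}`, `Submonoid.units`, `Subgroup.comap`, `Subgroup.relIndex`).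
-/
import Literature.NumberTheory.Automorphic.SplitTorusOrderCyclicLattices   -- ★ O7 (this seat): ring structure of `O[γ]`, criterion transport, lattices mod units (brings ★ O6)
import Mathlib.GroupTheory.Index
import Mathlib.Algebra.Group.Submonoid.Units
import Mathlib.RingTheory.Adjoin.Polynomial.Basic
import HarnessLib

/-!
# Self-dual cyclic `O[γ]`-lattices are a torsor under `C ∕ O[γ]^×`: `#{O[γ]·a self-dual} = [C : O[γ]^×]`

Topic `NumberTheory/Automorphic`; namespace `Literature.NumberTheory.Automorphic`.  THEOREMS ONLY (no definition, no instance, no notation, no named fact, no `sorry`); imports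
★ O7 `SplitTorusOrderCyclicLattices` (+ Mathlib group-index ∕ units ∕ adjoin API); any field `K`, any subring `O ≤ K`, ANY ring endomorphism `σ`, any `n`.  Cell
`pub/hodgecm-mathlib`, crux H413 = `stmt-HodgeConjecture-24833`; road «S3-tree», brick T3′, organ **O8a-1** (the TORSOR COUNT; the parity∕existence half O8a-2 and the index value
`[C : O[γ]^×] = (q+1)^{n−1}q^{S−n+1}` — organs O1–O4 of F0P3-p02 ∕ A-p19 — are separate).  HONEST LABEL: HC_CM is proved only modulo the cell's 2 remaining named inputs (hLiu418, h413)
until rung 0 closes; elementary algebra, asserts nothing printed.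

THE MATHEMATICS.  `γ : Fin n → K` injective with `γ i ∈ O`; the order `R = O[γ]` is carried by the HYPOTHESIS-FREE token `Algebra.adjoin O {γ} ≤ (Fin n → K)` (§1: it equals ★ O6∕O7's
`span_O {(γ_i^j)_i : j < n}`); its unit group `R^× := (Algebra.adjoin O {γ}).toSubmonoid.units ≤ (Fin n → K)ˣ` (Mathlib `Submonoid.units`: `↑u ∈ R ∧ ↑u⁻¹ ∈ R`); the norm map
`N(c) = c·σ(c)` is the monoid endomorphism `MonoidHom.id * Units.map (RingHom.pi (σ ∘ ev_i))` of the commutative group `(Fin n → K)ˣ`, and `C := R^×.comap N`.  For a diagonal form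
`d` the CRITERION VECTOR of `a : Fin n → K` is `T(a) := (d_i a_i σ(a_i) f′(γ_i))_i`, `f′(γ_i) = ∏_{j≠i}(γ_i − γ_j)`; `a` is GOOD iff `T(a) ∈ R` with unit components (= «the Gram matrix of
`O[γ]·a` for `diag(d)` lies in `GL_n(O)`», ★ O6 `gram_cyclic_integral_iff` + `det_gram_cyclic`).  THEOREM (`natCard_setOf_cyclicLattice_good_eq_relIndex`): if SOME `a₀` is good, then
  `#{M | ∃ a good, M = span_O {(γ_i^j a_i)_i}} = R^×.relIndex C = [C : R^×]`:
`c ↦ O[γ]·(c a₀)` maps `C` onto the good lattices (★ O7 `criterion_mem_of_norm_mem`, `norm_div_mem_of_criterion_mem`) with fibres the cosets of `R^× ⊓ C` (★ O7 `span_pow_mul_eq_of_unit`,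
`div_mem_span_pow_of_span_eq`).  No σ-stability of `O` or `R` is needed for the count (the fibre subgroup is `R^× ⊓ C` whatever `σ` is).

## References
* [Jacobowitz1962] R. Jacobowitz, *Hermitian forms over local fields*, Amer. J. Math. 84 (1962), §4–§7 (hermitian lattices, scaling, unimodular classification).
* [SerreLocalFields1979] J.-P. Serre, *Local Fields* (1979), Ch. III §6 (orders `A[x]`).
* [Rogawski1990] J. D. Rogawski, *Automorphic Representations of Unitary Groups in Three Variables* (1990), §4.9 Lemma 4.9.3 p. 56 (lattice counts as unit indices).
-/

set_option autoImplicit false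

open Polynomial Finset

namespace Literature.NumberTheory.Automorphic

variable {K : Type*} [Field K] {n : ℕ} (O : Subring K) {γ : Fin n → K}

/-! ## §1 The hypothesis-free token `Algebra.adjoin O {γ}` is the span of the powers -/

/-- `(Algebra.adjoin O {γ} p)` evaluates componentwise: `(aeval γ p) i = (p.map O.subtype).eval (γ i)`. [cite: SerreLocalFields1979, Ch. III §6] -/
theorem aeval_pi_apply (γ : Fin n → K) (p : O[X]) (i : Fin n) : (aeval γ p) i = (p.map O.subtype).eval (γ i) := by
  rw [show (aeval γ p) i = Pi.evalAlgHom O (fun _ : Fin n => K) i (aeval γ p) from rfl, ← Polynomial.aeval_algHom_apply,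
    Polynomial.aeval_def, Polynomial.eval_map]
  rfl

/-- **`Algebra.adjoin O {γ} = span_O {(γ_i^j)_i : j < n}`** as subsets of `Kⁿ` (nodes in `O`): the hypothesis-free subalgebra token IS ★ O6∕O7's order `R`.
[cite: SerreLocalFields1979, Ch. III §6] -/
theorem mem_adjoin_singleton_iff_mem_span_pow (hγ : ∀ i, γ i ∈ O) (x : Fin n → K) :
    x ∈ Algebra.adjoin O ({γ} : Set (Fin n → K)) ↔ x ∈ Submodule.span O (Set.range fun j : Fin n => fun i => γ i ^ (j : ℕ)) := by
  rw [Algebra.adjoin_singleton_eq_range_aeval, AlgHom.mem_range]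
  constructor
  · rintro ⟨p, rfl⟩
    have h : (aeval γ p : Fin n → K) = fun i => (p.map O.subtype).eval (γ i) := funext fun i => aeval_pi_apply O γ p i
    rw [h]
    exact eval_mem_span_pow O hγ p
  · intro hx
    obtain ⟨p, hp⟩ := exists_poly_of_mem_span_pow O hx
    exact ⟨p, funext fun i => by rw [aeval_pi_apply, hp i]⟩

/-- Units of the order: `u ∈ (Algebra.adjoin O {γ}).toSubmonoid.units ↔ ↑u ∈ R ∧ ↑u⁻¹ ∈ R` with `R` the span of the powers. [cite: SerreLocalFields1979, Ch. III §6] -/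
theorem mem_units_adjoin_iff (hγ : ∀ i, γ i ∈ O) (u : (Fin n → K)ˣ) :
    u ∈ (Algebra.adjoin O ({γ} : Set (Fin n → K))).toSubmonoid.units ↔
      (u : Fin n → K) ∈ Submodule.span O (Set.range fun j : Fin n => fun i => γ i ^ (j : ℕ)) ∧
        ((u⁻¹ : (Fin n → K)ˣ) : Fin n → K) ∈ Submodule.span O (Set.range fun j : Fin n => fun i => γ i ^ (j : ℕ)) := by
  rw [Submonoid.mem_units_iff]
  change (u : Fin n → K) ∈ Algebra.adjoin O ({γ} : Set (Fin n → K)) ∧ ((u⁻¹ : (Fin n → K)ˣ) : Fin n → K) ∈ Algebra.adjoin O ({γ} : Set (Fin n → K)) ↔ _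
  rw [mem_adjoin_singleton_iff_mem_span_pow O hγ, mem_adjoin_singleton_iff_mem_span_pow O hγ]

/-! ## §2 Units of `Kⁿ` with prescribed components; the norm endomorphism `N(c) = c·σ(c)` -/

/-- A vector with non-zero components is a unit of the ring `Kⁿ`. [cite: SerreLocalFields1979, Ch. III §6] -/
theorem isUnit_pi_of_forall_ne_zero {a : Fin n → K} (ha : ∀ i, a i ≠ 0) : IsUnit a :=
  isUnit_iff_exists_inv.2 ⟨fun i => (a i)⁻¹, funext fun i => by simp [ha i]⟩

/-- The norm endomorphism evaluates componentwise: `(N c) i = c i * σ (c i)`. [cite: Jacobowitz1962, §4] -/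
theorem norm_units_apply (σ : K →+* K) (c : (Fin n → K)ˣ) (i : Fin n) :
    (((MonoidHom.id (Fin n → K)ˣ * Units.map (RingHom.pi fun i : Fin n => σ.comp (Pi.evalRingHom (fun _ : Fin n => K) i)).toMonoidHom) c : (Fin n → K)ˣ) :
        Fin n → K) i = (c : Fin n → K) i * σ ((c : Fin n → K) i) := by
  rw [MonoidHom.mul_apply, Units.val_mul, Pi.mul_apply, MonoidHom.id_apply, Units.coe_map]
  rfl

/-! ## §3 THE TORSOR COUNT -/

/-- **THE SELF-DUAL CYCLIC LATTICES ARE A `C ∕ R^×`-TORSOR: `#{O[γ]·a : a good} = [C : R^×]`.**  `K` a field, `O ≤ K` a subring, `γ : Fin n → K` injective with `γ i ∈ O`,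
`σ : K →+* K` ANY ring endomorphism, `d : Fin n → K` (the diagonal form in the eigenframe); `R := Algebra.adjoin O {γ}` (= `span_O {γ^j}`), `R^× := R.toSubmonoid.units`,
`N := id * Units.map (σ componentwise)` (`N(c) = c·σ(c)`), `C := R^×.comap N`.  Call `a` GOOD when its criterion vector `T(a) = (d_i a_i σ(a_i) ∏_{j≠i}(γ_i − γ_j))_i` lies in
`span_O {γ^j}` with every component a unit of `O` (⟺ the Gram matrix of the cyclic lattice `O[γ]·a` for `diag(d)` lies in `GL_n(O)`, ★ O6).  If some `a₀` is good, then
`Nat.card {M : Submodule O Kⁿ | ∃ a good, M = span_O {(γ_i^j a_i)_i}} = R^×.relIndex C`. [cite: Jacobowitz1962, §4–§7] [cite: Rogawski1990, §4.9 Lemma 4.9.3 p. 56] -/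
theorem natCard_setOf_cyclicLattice_good_eq_relIndex (hγ : ∀ i, γ i ∈ O) (σ : K →+* K) (d : Fin n → K)
    (a₀ : Fin n → K)
    (ha₀ : (fun i => d i * a₀ i * σ (a₀ i) * ∏ j ∈ univ.erase i, (γ i - γ j)) ∈ Submodule.span O (Set.range fun j : Fin n => fun i => γ i ^ (j : ℕ)))
    (ha₀u : ∀ i, ∃ y ∈ O, y * (d i * a₀ i * σ (a₀ i) * ∏ j ∈ univ.erase i, (γ i - γ j)) = 1) :
    Nat.card {M : Submodule O (Fin n → K) //
        ∃ a : Fin n → K,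
          ((fun i => d i * a i * σ (a i) * ∏ j ∈ univ.erase i, (γ i - γ j)) ∈ Submodule.span O (Set.range fun j : Fin n => fun i => γ i ^ (j : ℕ)) ∧
            ∀ i, ∃ y ∈ O, y * (d i * a i * σ (a i) * ∏ j ∈ univ.erase i, (γ i - γ j)) = 1) ∧
          M = Submodule.span O (Set.range fun j : Fin n => fun i => γ i ^ (j : ℕ) * a i)} =
      ((Algebra.adjoin O ({γ} : Set (Fin n → K))).toSubmonoid.units).relIndex
        (((Algebra.adjoin O ({γ} : Set (Fin n → K))).toSubmonoid.units).comap
          (MonoidHom.id (Fin n → K)ˣ * (Units.map (RingHom.pi fun i : Fin n => σ.comp (Pi.evalRingHom (fun _ : Fin n => K) i)).toMonoidHom))) := by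
  classical
  -- names
  set Rs : Submodule O (Fin n → K) := Submodule.span O (Set.range fun j : Fin n => fun i => γ i ^ (j : ℕ)) with hRs
  set Ru : Subgroup (Fin n → K)ˣ := (Algebra.adjoin O ({γ} : Set (Fin n → K))).toSubmonoid.units with hRu
  set Nh : (Fin n → K)ˣ →* (Fin n → K)ˣ :=
    MonoidHom.id (Fin n → K)ˣ * (Units.map (RingHom.pi fun i : Fin n => σ.comp (Pi.evalRingHom (fun _ : Fin n => K) i)).toMonoidHom) with hNh
  set C : Subgroup (Fin n → K)ˣ := Ru.comap Nh with hC
  -- the criterion vector, goodness, the lattice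
  let T : (Fin n → K) → (Fin n → K) := fun a i => d i * a i * σ (a i) * ∏ j ∈ univ.erase i, (γ i - γ j)
  let Good : (Fin n → K) → Prop := fun a => T a ∈ Rs ∧ ∀ i, ∃ y ∈ O, y * T a i = 1
  let Lat : (Fin n → K) → Submodule O (Fin n → K) := fun a => Submodule.span O (Set.range fun j : Fin n => fun i => γ i ^ (j : ℕ) * a i)
  have hN_apply : ∀ (c : (Fin n → K)ˣ) (i : Fin n), ((Nh c : (Fin n → K)ˣ) : Fin n → K) i = (c : Fin n → K) i * σ ((c : Fin n → K) i) :=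
    fun c i => norm_units_apply σ c i
  have hRu_iff : ∀ u : (Fin n → K)ˣ, u ∈ Ru ↔ (u : Fin n → K) ∈ Rs ∧ ((u⁻¹ : (Fin n → K)ˣ) : Fin n → K) ∈ Rs := fun u => mem_units_adjoin_iff O hγ u
  -- components of a unit of `Kⁿ` are non-zero
  have units_ne : ∀ (w : (Fin n → K)ˣ) (i : Fin n), (w : Fin n → K) i ≠ 0 := fun w i h0 => by
    have := congrFun (congrArg (fun u : (Fin n → K)ˣ => (u : Fin n → K)) (inv_mul_cancel w)) i
    rw [Units.val_mul, Pi.mul_apply, h0, mul_zero, Units.val_one, Pi.one_apply] at this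
    exact zero_ne_one this
  -- goodness: components of `a` (and of `T a`) are non-zero
  have good_ne : ∀ {a : Fin n → K}, Good a → ∀ i, a i ≠ 0 := by
    intro a ha i h0
    obtain ⟨y, -, hy⟩ := ha.2 i
    apply zero_ne_one (α := K)
    rw [← hy]
    simp [T, h0]
  have goodT_ne : ∀ {a : Fin n → K}, Good a → ∀ i, T a i ≠ 0 := by
    intro a ha i h0
    obtain ⟨y, -, hy⟩ := ha.2 i
    rw [h0, mul_zero] at hy
    exact zero_ne_one hy
  -- goodness transports along `N(c) ∈ R^×` (★ O7 §2)
  have good_smul : ∀ {a : Fin n → K} (c : (Fin n → K)ˣ), Good a → c ∈ C → Good ((c : Fin n → K) * a) := by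
    intro a c ha hc
    rw [hC, Subgroup.mem_comap, hRu_iff] at hc
    have hNc : (fun i => (c : Fin n → K) i * σ ((c : Fin n → K) i)) = ((Nh c : (Fin n → K)ˣ) : Fin n → K) := funext fun i => (hN_apply c i).symm
    refine ⟨?_, fun i => ?_⟩
    · have h := criterion_mem_of_norm_mem O σ hγ (d := d) (a := a) (c := (c : Fin n → K)) ha.1 (by rw [hNc]; exact hc.1)
      simpa only [T, Pi.mul_apply] using h
    · -- unit components: `(N c) i` is a unit of `O` (its inverse `(N c)⁻¹ i ∈ O`) and `T a i` is
      obtain ⟨y, hy, hya⟩ := ha.2 i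
      have hinvR : (((Nh c)⁻¹ : (Fin n → K)ˣ) : Fin n → K) ∈ Rs := hc.2
      have hinvO : (((Nh c)⁻¹ : (Fin n → K)ˣ) : Fin n → K) i ∈ O := apply_mem_of_mem_span_pow O hγ hinvR i
      refine ⟨(((Nh c)⁻¹ : (Fin n → K)ˣ) : Fin n → K) i * y, Subring.mul_mem _ hinvO hy, ?_⟩
      have hmul : (((Nh c)⁻¹ : (Fin n → K)ˣ) : Fin n → K) i * ((Nh c : (Fin n → K)ˣ) : Fin n → K) i = 1 := by
        have := congrFun (congrArg (fun u : (Fin n → K)ˣ => (u : Fin n → K)) (inv_mul_cancel (Nh c))) i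
        simpa only [Units.val_mul, Pi.mul_apply, Units.val_one, Pi.one_apply] using this
      have hTca : T ((c : Fin n → K) * a) i = ((Nh c : (Fin n → K)ˣ) : Fin n → K) i * T a i := by
        simp only [T, Pi.mul_apply, hN_apply, map_mul]
        ring
      rw [hTca]
      calc (((Nh c)⁻¹ : (Fin n → K)ˣ) : Fin n → K) i * y * ((((Nh c : (Fin n → K)ˣ) : Fin n → K) i) * T a i)
          = ((((Nh c)⁻¹ : (Fin n → K)ˣ) : Fin n → K) i * ((Nh c : (Fin n → K)ˣ) : Fin n → K) i) * (y * T a i) := by ring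
        _ = 1 := by rw [hmul, hya, one_mul]
  -- two good vectors differ by an element of `C` (★ O7 `norm_div_mem_of_criterion_mem`)
  have good_div : ∀ {a a' : Fin n → K} (ha : Good a) (ha' : Good a'),
      ∃ c : (Fin n → K)ˣ, c ∈ C ∧ (c : Fin n → K) * a = a' := by
    intro a a' ha ha'
    have hq : ∀ i, a' i / a i ≠ 0 := fun i => div_ne_zero (good_ne ha' i) (good_ne ha i)
    obtain ⟨c, hc⟩ := isUnit_pi_of_forall_ne_zero hq
    refine ⟨c, ?_, ?_⟩
    · rw [hC, Subgroup.mem_comap, hRu_iff]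
      have hN : ((Nh c : (Fin n → K)ˣ) : Fin n → K) = fun i => (a' i / a i) * σ (a' i / a i) := by
        funext i; rw [hN_apply, hc]
      have hNinv : (((Nh c)⁻¹ : (Fin n → K)ˣ) : Fin n → K) = fun i => (a i / a' i) * σ (a i / a' i) := by
        rw [← map_inv]
        funext i
        rw [hN_apply, Units.val_inv_eq_inv_val, Pi.inv_apply, hc]
        simp only [map_div₀, inv_div]
      refine ⟨?_, ?_⟩
      · rw [hN]
        exact norm_div_mem_of_criterion_mem O σ hγ ha.1 ha.2 ha'.1
      · rw [hNinv]
        exact norm_div_mem_of_criterion_mem O σ hγ ha'.1 ha'.2 ha.1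
    · funext i
      rw [Pi.mul_apply, hc]
      exact div_mul_cancel₀ _ (good_ne ha i)
  -- the map `C → good lattices`, `c ↦ O[γ]·(c a₀)`
  have hGood₀ : Good a₀ := ⟨ha₀, ha₀u⟩
  let f : C → {M : Submodule O (Fin n → K) // ∃ a, Good a ∧ M = Lat a} :=
    fun c => ⟨Lat ((c : (Fin n → K)ˣ) * a₀ : Fin n → K), _, good_smul (c : (Fin n → K)ˣ) hGood₀ c.2, rfl⟩
  -- surjective
  have hf_surj : Function.Surjective f := by
    rintro ⟨M, a, ha, rfl⟩
    obtain ⟨c, hcC, hca⟩ := good_div hGood₀ ha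
    exact ⟨⟨c, hcC⟩, Subtype.ext (by simp only [f]; rw [hca])⟩
  -- fibres = cosets of `R^× ⊓ C`
  have hf_ker : ∀ c c' : C, f c = f c' ↔ (QuotientGroup.leftRel (Ru.subgroupOf C)) c c' := by
    intro c c'
    rw [QuotientGroup.leftRel_apply, Subgroup.mem_subgroupOf, Subgroup.coe_mul, Subgroup.coe_inv, hRu_iff]
    have hu : (((c : (Fin n → K)ˣ)⁻¹ * (c' : (Fin n → K)ˣ) : (Fin n → K)ˣ) : Fin n → K) =
        fun i => (((c' : (Fin n → K)ˣ) : Fin n → K) i * a₀ i) / (((c : (Fin n → K)ˣ) : Fin n → K) i * a₀ i) := by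
      funext i
      have hci : ((c : (Fin n → K)ˣ) : Fin n → K) i ≠ 0 := units_ne _ i
      rw [Units.val_mul, Pi.mul_apply, Units.val_inv_eq_inv_val, Pi.inv_apply, mul_div_mul_right _ _ (good_ne hGood₀ i)]
      field_simp
    have hu' : ((((c : (Fin n → K)ˣ)⁻¹ * (c' : (Fin n → K)ˣ))⁻¹ : (Fin n → K)ˣ) : Fin n → K) =
        fun i => (((c : (Fin n → K)ˣ) : Fin n → K) i * a₀ i) / (((c' : (Fin n → K)ˣ) : Fin n → K) i * a₀ i) := by
      rw [Units.val_inv_eq_inv_val, hu]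
      funext i
      rw [Pi.inv_apply, inv_div]
    constructor
    · intro h
      have hM : Lat (((c : (Fin n → K)ˣ) : Fin n → K) * a₀) = Lat (((c' : (Fin n → K)ˣ) : Fin n → K) * a₀) := congrArg Subtype.val h
      refine ⟨?_, ?_⟩
      · rw [hu]
        exact div_mem_span_pow_of_span_eq O hγ (fun i => mul_ne_zero (units_ne _ i) (good_ne hGood₀ i)) hM.symm
      · rw [hu']
        exact div_mem_span_pow_of_span_eq O hγ (fun i => mul_ne_zero (units_ne _ i) (good_ne hGood₀ i)) hM
    · rintro ⟨hm, hm'⟩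
      apply Subtype.ext
      simp only [f]
      -- `c' a₀ = u • (c a₀)` with `u = c⁻¹ c'` a unit of `R`
      set u : Fin n → K := (((c : (Fin n → K)ˣ)⁻¹ * (c' : (Fin n → K)ˣ) : (Fin n → K)ˣ) : Fin n → K) with hudef
      have hu0 : ∀ i, u i ≠ 0 := fun i => by rw [hudef]; exact units_ne _ i
      have hinv : u⁻¹ = ((((c : (Fin n → K)ˣ)⁻¹ * (c' : (Fin n → K)ˣ))⁻¹ : (Fin n → K)ˣ) : Fin n → K) := by
        rw [hudef, Units.val_inv_eq_inv_val]
      have hca : (((c' : (Fin n → K)ˣ) : Fin n → K) * a₀) = fun i => u i * ((((c : (Fin n → K)ˣ) : Fin n → K) * a₀) i) := by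
        funext i
        have hne : ((c : (Fin n → K)ˣ) : Fin n → K) i * a₀ i ≠ 0 := mul_ne_zero (units_ne _ i) (good_ne hGood₀ i)
        rw [hu, Pi.mul_apply, Pi.mul_apply]
        exact (div_mul_cancel₀ _ hne).symm
      change Lat (((c : (Fin n → K)ˣ) : Fin n → K) * a₀) = Lat (((c' : (Fin n → K)ˣ) : Fin n → K) * a₀)
      rw [hca]
      exact (span_pow_mul_eq_of_unit O hγ ((((c : (Fin n → K)ˣ) : Fin n → K) * a₀)) hm (by rw [← hinv] at hm'; exact hm') hu0).symm
  -- assemble: `{good lattices} ≃ C ⧸ (R^× ⊓ C)`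
  have hker : Setoid.ker f = QuotientGroup.leftRel (Ru.subgroupOf C) := by
    ext c c'
    exact hf_ker c c'
  have e : Quotient (Setoid.ker f) ≃ {M : Submodule O (Fin n → K) // ∃ a, Good a ∧ M = Lat a} := Setoid.quotientKerEquivOfSurjective f hf_surj
  rw [Subgroup.relIndex, Subgroup.index_eq_card]
  have e' : (C ⧸ Ru.subgroupOf C) ≃ Quotient (Setoid.ker f) := Quotient.congrRight fun c c' => by
    rw [hker]
  exact (Nat.card_congr (e'.trans e)).symm

end Literature.NumberTheory.Automorphic
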